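import Mathlib
import HarnessLib
import Summits.HubbardSuperconductivity.HubbardSuperconductivity.Theorems.KLProgrammeKLRegimeCountertermJacksonRemainderFlow

/-!
# Route `KLProgramme`, crux K3 — gen-8 ENGINE-FLOW child (stmt-HubbardSuperconductivity-20437 `KLRegimeEngineV17F2`), stub (C)
# `stub_twoLeg_curvature`, door (C1) part 5: the ANGULAR MEAN passes through the Jackson step EXACTLY — the remainder and all its size
# hypotheses are MEAN-FREE (row «δμ-flow with klAngularMean constant piece»)

Seat hubbard-kl-k3c3-p1 (g5).  The G-extension splits as `E_μ f = mean f + E_μ(f − mean f)` (p2's `klFrameExtFn_eq_mean_add`) and the Jackson mean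
reproduces constants (`jsmooth_const`, k3c3-p2), so `jhigh1 d (E_μ f) = jhigh1 d (E_μ(f − mean f))`: the (C1) remainder of part 3
(`flowPiece_eval_sub_eq_neg_jhigh1`, p533953) is the remainder of the MEAN-FREE extension, and the door may be fed the sizes of
`F₀ := onM (E_μ(ν_n(K_n) − mean))` — whose global sizes (k3c3-p1 g2 `norm_iteratedFDeriv_onM_klFrameExtFn_le` with `mean (f − mean f) = 0`) and local
value carry NO `|mean f| = O(U)` term; the O(U) δμ-part of the reading never enters the (C1) bounds (value law `(c₀ + c′₀|U|)|U|16^{−n}` vs the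
`U²`-laws of the jets).

* `jhigh1_klFrameExtFn_eq_meanFree`, `flowPiece_eval_sub_eq_neg_jhigh1_meanFree`, **`flowPiece_reading_remainder_jets_meanFree`** (value + four jets of
  `R = (klFlowPiece n).eval ∘ k_F^{K′} − ν_n(K_n)` from `B`, `Ml` of `F₀`, honest curve jets `D`, margin `δ`, first-moment bound `m₁`).

Proofs only; no definitions; nothing about the model; nothing here asserts superconductivity.
-/

noncomputable section

namespace Summit.HubbardSuperconductivity.HubbardSuperconductivity.Theorems.KLRegimeSplit

set_option linter.dupNamespace false -- summit = problem name (single-conjunct summit), D-0017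

open Real MeasureTheory Filter
open Literature.Analysis.Fourier.TrigApprox Literature.MathematicalPhysics.QuantumLattice
open Summit.HubbardSuperconductivity.HubbardSuperconductivity.Theorems.PerturbedFermiCurve

/-! ## §1 The constant piece passes through the Jackson step exactly: the remainder is blind to the angular mean -/

section MeanFree

variable {L M : ℕ} [NeZero L] [NeZero M]

omit [NeZero L] [NeZero M] in
/-- **`jhigh1` of the G-extension depends only on the mean-free profile**: `jhigh1 d (E_μ f) = jhigh1 d (E_μ (f − mean f))` — the constant frame
`mean f` is reproduced EXACTLY by the Jackson mean (`jsmooth_const`), so the (C1) remainder carries no δμ / angular-mean piece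
(row «δμ-flow with klAngularMean constant piece»).  `f` continuous and `2π`-periodic, `μ ∈ klWindowC` (continuity of the extension). -/
theorem jhigh1_klFrameExtFn_eq_meanFree (d : ℕ) {μ : ℝ} (hμ : μ ∈ klWindowC) {f : ℝ → ℝ} (hf : Continuous f)
    (hper : Function.Periodic f (2 * Real.pi)) :
    jhigh1 d (klFrameExtFn μ f) = jhigh1 d (klFrameExtFn μ fun t => f t - klAngularMean f) := by
  have hfi : IntervalIntegrable f MeasureTheory.volume 0 (2 * π) := hf.intervalIntegrable _ _
  have hsplit : klFrameExtFn μ f = fun p => klAngularMean f + klFrameExtFn μ (fun t => f t - klAngularMean f) p :=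
    funext fun p => klFrameExtFn_eq_mean_add μ hfi p
  have hg : ContDiff ℝ 0 (fun t : ℝ => f t - klAngularMean f) := contDiff_zero.mpr (hf.sub continuous_const)
  have hgper : Function.Periodic (fun t : ℝ => f t - klAngularMean f) (2 * Real.pi) := fun t => by
    show f (t + 2 * Real.pi) - klAngularMean f = f t - klAngularMean f
    rw [hper t]
  have hc : Continuous (klFrameExtFn μ fun t => f t - klAngularMean f) :=
    continuous_klFrameExtFn_of_contDiff (contDiff_onM_klFrameExtFn (N := 0) hg hgper hμ)
  funext p
  simp only [jhigh1]
  rw [hsplit, jsmooth_add d continuous_const hc p, jsmooth_const]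
  ring

/-- **THE (C1) OBJECT, MEAN-FREE FORM**: `(klFlowPiece n).eval (k_F^{K′} θ) − ν_n(K_n)(θ) = −[jhigh1 (klFlowDeg n) (E_μ(ν_n(K_n) − mean))](k_F^{K′} θ)`. -/
theorem flowPiece_eval_sub_eq_neg_jhigh1_meanFree (β U : ℝ) {μ : ℝ} (hμ : μ ∈ klWindowC) (n : ℕ) (K' : TrigPolyC4v)
    (hf : ContDiff ℝ 4 fun θ : ℝ => klLocalPart L M β U μ (klFlowFrameU L M β U μ n) n θ)
    (hon : ∀ θ, klFrameExtFn μ (fun θ => klLocalPart L M β U μ (klFlowFrameU L M β U μ n) n θ) (klFermiPoint μ K' θ) =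
      klLocalPart L M β U μ (klFlowFrameU L M β U μ n) n θ) :
    (fun θ => (klFlowPiece L M β U μ n).eval (klFermiPoint μ K' θ) - klLocalPart L M β U μ (klFlowFrameU L M β U μ n) n θ) =
      fun θ => -(((fun q : EuclideanSpace ℝ (Fin 2) =>
        jhigh1 (klFlowDeg n) (klFrameExtFn μ fun θ => klLocalPart L M β U μ (klFlowFrameU L M β U μ n) n θ -
          klAngularMean fun θ => klLocalPart L M β U μ (klFlowFrameU L M β U μ n) n θ) (WithLp.ofLp q)) ∘
          fun θ => (WithLp.toLp 2 (klFermiPoint μ K' θ) : EuclideanSpace ℝ (Fin 2))) θ) := by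
  rw [flowPiece_eval_sub_eq_neg_jhigh1 (L := L) (M := M) β U hμ n K' hf hon,
    jhigh1_klFrameExtFn_eq_meanFree (klFlowDeg n) hμ hf.continuous (klLocalPart_periodic β U μ _ n)]

/-- **THE (C1) DOOR AT THE FLOW PIECE, MEAN-FREE SIZES.**  As `flowPiece_reading_remainder_jets`, but every size hypothesis is on the MEAN-FREE
extension `F₀ := onM (klFrameExtFn μ (f − mean f))`, `f = ν_n(K_n)`: GLOBAL `‖DⁱF₀‖ ≤ B i` (k3c3-p1 g2 `norm_iteratedFDeriv_onM_klFrameExtFn_le` with NO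
`|mean|` term, `klAngularMean_sub_mean`), LOCAL `‖DⁱF₀(y)‖ ≤ Ml i` on the `r`-ball (`localSizes_onM_klFrameExtFn_of_ball` with `mean (f − mean) = 0`: order
`0` is `sup|f − mean|`, orders `≥ 1` the graded table), so the O(U) angular mean of the reading never enters the remainder's bounds. -/
theorem flowPiece_reading_remainder_jets_meanFree (β U : ℝ) {μ : ℝ} (hμ : μ ∈ klWindowC) (n : ℕ) (K' : TrigPolyC4v)
    (hf : ContDiff ℝ 4 fun θ : ℝ => klLocalPart L M β U μ (klFlowFrameU L M β U μ n) n θ)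
    (hon : ∀ θ, klFrameExtFn μ (fun θ => klLocalPart L M β U μ (klFlowFrameU L M β U μ n) n θ) (klFermiPoint μ K' θ) =
      klLocalPart L M β U μ (klFlowFrameU L M β U μ n) n θ)
    {B : ℕ → ℝ} (hB : ∀ i ≤ 4, ∀ y, ‖iteratedFDeriv ℝ i
      (onM (klFrameExtFn μ fun θ => klLocalPart L M β U μ (klFlowFrameU L M β U μ n) n θ -
        klAngularMean fun θ => klLocalPart L M β U μ (klFlowFrameU L M β U μ n) n θ)) y‖ ≤ B i)
    (hγ : ContDiff ℝ 4 fun θ => (WithLp.toLp 2 (klFermiPoint μ K' θ) : EuclideanSpace ℝ (Fin 2)))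
    {θ r δ D : ℝ} {Ml : ℕ → ℝ}
    (hMl : ∀ i ≤ 4, ∀ y : EuclideanSpace ℝ (Fin 2), ‖y - WithLp.toLp 2 (klFermiPoint μ K' θ)‖ ≤ r →
      ‖iteratedFDeriv ℝ i (onM (klFrameExtFn μ fun θ => klLocalPart L M β U μ (klFlowFrameU L M β U μ n) n θ -
        klAngularMean fun θ => klLocalPart L M β U μ (klFlowFrameU L M β U μ n) n θ)) y‖ ≤ Ml i)
    (hδ : 0 < δ) (hδπ : δ ≤ π) (hδr : 2 * δ ≤ r) {m₁ : ℝ} (hm₁ : ∫ w, jweight (klFlowDeg n) w * (|w.1| + |w.2|) ∂jmeas ≤ m₁)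
    (hD : ∀ i, 1 ≤ i → i ≤ 4 →
      ‖iteratedDeriv i (fun θ => (WithLp.toLp 2 (klFermiPoint μ K' θ) : EuclideanSpace ℝ (Fin 2))) θ‖ ≤ D ^ i) :
    |(klFlowPiece L M β U μ n).eval (klFermiPoint μ K' θ) - klLocalPart L M β U μ (klFlowFrameU L M β U μ n) n θ| ≤
      Ml 1 * m₁ + (B 0 + Ml 0) * (π ^ 3 / ((klFlowDeg n + 1) * δ) ^ 3) ∧
    |iteratedDeriv 1 (fun θ => (klFlowPiece L M β U μ n).eval (klFermiPoint μ K' θ) -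
        klLocalPart L M β U μ (klFlowFrameU L M β U μ n) n θ) θ| ≤
      (Ml 2 * m₁ + (B 1 + Ml 1) * (π ^ 3 / ((klFlowDeg n + 1) * δ) ^ 3)) * D ∧
    |iteratedDeriv 2 (fun θ => (klFlowPiece L M β U μ n).eval (klFermiPoint μ K' θ) -
        klLocalPart L M β U μ (klFlowFrameU L M β U μ n) n θ) θ| ≤
      ((Ml 3 * m₁ + (B 2 + Ml 2) * (π ^ 3 / ((klFlowDeg n + 1) * δ) ^ 3)) +
        (Ml 2 * m₁ + (B 1 + Ml 1) * (π ^ 3 / ((klFlowDeg n + 1) * δ) ^ 3))) * D ^ 2 ∧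
    |iteratedDeriv 3 (fun θ => (klFlowPiece L M β U μ n).eval (klFermiPoint μ K' θ) -
        klLocalPart L M β U μ (klFlowFrameU L M β U μ n) n θ) θ| ≤
      ((Ml 4 * m₁ + (B 3 + Ml 3) * (π ^ 3 / ((klFlowDeg n + 1) * δ) ^ 3)) +
        3 * (Ml 3 * m₁ + (B 2 + Ml 2) * (π ^ 3 / ((klFlowDeg n + 1) * δ) ^ 3)) +
        (Ml 2 * m₁ + (B 1 + Ml 1) * (π ^ 3 / ((klFlowDeg n + 1) * δ) ^ 3))) * D ^ 3 ∧
    |iteratedDeriv 4 (fun θ => (klFlowPiece L M β U μ n).eval (klFermiPoint μ K' θ) -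
        klLocalPart L M β U μ (klFlowFrameU L M β U μ n) n θ) θ| ≤
      ((2 * Ml 4 + B 4 * (π ^ 3 / ((klFlowDeg n + 1) * δ) ^ 3)) +
        6 * (Ml 4 * m₁ + (B 3 + Ml 3) * (π ^ 3 / ((klFlowDeg n + 1) * δ) ^ 3)) +
        7 * (Ml 3 * m₁ + (B 2 + Ml 2) * (π ^ 3 / ((klFlowDeg n + 1) * δ) ^ 3)) +
        (Ml 2 * m₁ + (B 1 + Ml 1) * (π ^ 3 / ((klFlowDeg n + 1) * δ) ^ 3))) * D ^ 4 := by
  set f : ℝ → ℝ := fun θ => klLocalPart L M β U μ (klFlowFrameU L M β U μ n) n θ with hfdef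
  set F₀ : (Fin 2 → ℝ) → ℝ := klFrameExtFn μ fun t => f t - klAngularMean f with hF₀def
  set γ : ℝ → EuclideanSpace ℝ (Fin 2) := fun θ => WithLp.toLp 2 (klFermiPoint μ K' θ) with hγdef
  have hper : Function.Periodic f (2 * Real.pi) := klLocalPart_periodic β U μ _ n
  have hg : ContDiff ℝ 4 (fun t : ℝ => f t - klAngularMean f) := hf.sub contDiff_const
  have hgper : Function.Periodic (fun t : ℝ => f t - klAngularMean f) (2 * Real.pi) := fun t => by
    show f (t + 2 * Real.pi) - klAngularMean f = f t - klAngularMean f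
    rw [hper t]
  have hG : ContDiff ℝ 4 (fun q : EuclideanSpace ℝ (Fin 2) => F₀ (WithLp.ofLp q)) := contDiff_onM_klFrameExtFn (N := 4) hg hgper hμ
  have hFc : Continuous F₀ := continuous_of_continuous_comp_ofLp hG.continuous
  have hB' : ∀ i ≤ 4, ∀ y, ‖iteratedFDeriv ℝ i (fun q : EuclideanSpace ℝ (Fin 2) => F₀ (WithLp.ofLp q)) y‖ ≤ B i := hB
  have hMl' : ∀ i ≤ 4, ∀ y : EuclideanSpace ℝ (Fin 2), ‖y - γ θ‖ ≤ r →
      ‖iteratedFDeriv ℝ i (fun q : EuclideanSpace ℝ (Fin 2) => F₀ (WithLp.ofLp q)) y‖ ≤ Ml i := hMl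
  have hobj := flowPiece_eval_sub_eq_neg_jhigh1_meanFree (L := L) (M := M) β U hμ n K' hf hon
  have hR : (fun θ => (klFlowPiece L M β U μ n).eval (klFermiPoint μ K' θ) - f θ) =
      -((fun q : EuclideanSpace ℝ (Fin 2) => jhigh1 (klFlowDeg n) F₀ (WithLp.ofLp q)) ∘ γ) := by
    rw [hobj]; rfl
  obtain ⟨j1, j2, j3, j4⟩ := jacksonRemainder_curve_jets (klFlowDeg n) hFc hG hB' hγ hMl' hδ hδπ hδr hm₁ hD
  have hval := abs_jhigh1_curve_le (klFlowDeg n) hFc hG hB' hMl' hδ hδπ hδr hm₁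
  refine ⟨?_, ?_, ?_, ?_, ?_⟩
  · have e : (klFlowPiece L M β U μ n).eval (klFermiPoint μ K' θ) - f θ =
        -(((fun q : EuclideanSpace ℝ (Fin 2) => jhigh1 (klFlowDeg n) F₀ (WithLp.ofLp q)) ∘ γ) θ) := congrFun hR θ
    rw [e, abs_neg]
    exact hval
  · rw [hR, iteratedDeriv_neg, abs_neg]; exact j1
  · rw [hR, iteratedDeriv_neg, abs_neg]; exact j2
  · rw [hR, iteratedDeriv_neg, abs_neg]; exact j3
  · rw [hR, iteratedDeriv_neg, abs_neg]; exact j4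

end MeanFree

end Summit.HubbardSuperconductivity.HubbardSuperconductivity.Theorems.KLRegimeSplit

end
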